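import Mathlib.LinearAlgebra.Matrix.SpecialLinearGroup
import Mathlib.NumberTheory.SumTwoSquares
import Mathlib.GroupTheory.QuotientGroup.Basic
import HarnessLib

set_option autoImplicit false
set_option linter.dupNamespace false

/-!
# `SL₂(𝔽_q)`, `q` an odd prime: involutions, square roots of `-1`, and homomorphisms of exponent `2`

Summit `BirchSwinnertonDyer`, route `ManinLocalTwoThree` (cell bsd-f2-manin), crux C2 `ManinOddAtFour`
(stmt-BirchSwinnertonDyer-22967), line `kato_shift_two` v7, registered stub `stub_sl2OddPrimeExtensionFact :
sl2ZModOddPrime_existsUnique_extension_of_stable_character` (the named Literature fact F-es-27′,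
`Literature/GroupTheory/SpecificGroups/SL2OddPrimeStableCharacterExtension.lean`, a derived reading of
Fiedorowicz–Priddy 1978 VI.5.4).  This is MODULE A/1 of an ELEMENTARY proof of that fact (no cohomology ring, no
Schur-multiplier theory): pure `2 × 2` matrix algebra in `SL(2, ZMod q)` for an odd prime `q`:

* `eq_one_or_eq_neg_one_of_mul_self_eq_one` — `-1` is the unique involution (`g² = 1 ⇒ g = ±1`);
* `monoidHom_eq_one_of_forall_mul_self_eq_one` — a homomorphism `SL₂(𝔽_q) → M` all of whose values square to `1`
  is trivial (every element is a product of four elementary unipotents, and a unipotent `u(a) = u(a/2)²` is a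
  square); `monoidHom_eq_one_of_forall_mul_self_eq_one_of_ker_le` — the same for a group `E` surjecting onto
  `SL₂(𝔽_q)` (used twice downstream: lifts of `-1` are central in every central extension with exponent-`2` kernel,
  and UNIQUENESS of the extended character);
* `add_eq_zero_of_mul_self_eq_neg_one` — an element with `x² = -1` has trace `0`;
* `exists_conj_eq_of_mul_self_eq_neg_one` — any two elements with square `-1` are conjugate IN `SL₂(𝔽_q)`
  (conjugate to `w = (0 -1; 1 0)` by `[v | xv]·m` with `m` in the centraliser torus of `w` chosen by the two-squares
  identity `ZMod.sq_add_sq` so that the determinant is `1`).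

No definitions; nothing about BSD or the Manin constant is asserted here.  Standard material (L. E. Dickson,
*Linear Groups* (1901), Ch. XII; B. Huppert, *Endliche Gruppen I*, II §8).
-/

open scoped MatrixGroups

namespace Summit.BirchSwinnertonDyer.BirchSwinnertonDyer.Theorems.ManinLocalTwoThree

namespace SL2ZModOddPrime

variable {q : ℕ} [Fact q.Prime]

/-- In `ZMod q`, `q` an odd prime, `2 ≠ 0` (as a `NeZero` fact; cf. `two_ne_zero_zmod` in the X6 certificate
files, not imported here to keep this module light). [folklore] -/
theorem neZero_two (hq : q ≠ 2) : NeZero (2 : ZMod q) := by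
  constructor
  intro h
  have h' : ((2 : ℕ) : ZMod q) = 0 := by exact_mod_cast h
  rw [ZMod.natCast_eq_zero_iff] at h'
  have h2 : q ≤ 2 := Nat.le_of_dvd (by norm_num) h'
  have h3 : 2 ≤ q := (Fact.out : q.Prime).two_le
  exact hq (le_antisymm h2 h3)

/-- In `SL(2, ZMod q)`, `q` an odd prime, `-1 ≠ 1`. [folklore] -/
theorem neg_one_ne_one (hq : q ≠ 2) : (-1 : SL(2, ZMod q)) ≠ 1 := by
  intro h
  have h00 := congrArg (fun m : SL(2, ZMod q) => (m : Matrix (Fin 2) (Fin 2) (ZMod q)) 0 0) h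
  simp only [Matrix.SpecialLinearGroup.coe_neg, Matrix.SpecialLinearGroup.coe_one, Matrix.neg_apply,
    Matrix.one_apply_eq] at h00
  apply (neZero_two hq).out
  linear_combination -h00

/-- Entries of a product in `SL(2, R)` (plumbing). [folklore] -/
theorem mul_apply_two {R : Type*} [CommRing R] (g h : SL(2, R)) (i j : Fin 2) :
    (g * h) i j = g i 0 * h 0 j + g i 1 * h 1 j := by
  simp [Matrix.SpecialLinearGroup.coe_mul, Matrix.mul_apply, Fin.sum_univ_two]

/-- The determinant relation of an element of `SL(2, R)` (plumbing). [folklore] -/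
theorem det_two {R : Type*} [CommRing R] (g : SL(2, R)) : g 0 0 * g 1 1 - g 0 1 * g 1 0 = 1 := by
  have := g.det_coe
  rw [Matrix.det_fin_two] at this
  exact this

/-- **`-1` is the unique involution of `SL₂(𝔽_q)`, `q` odd**: `g * g = 1` forces `g = 1` or `g = -1`.
[folklore] -/
theorem eq_one_or_eq_neg_one_of_mul_self_eq_one (hq : q ≠ 2) (g : SL(2, ZMod q)) (h : g * g = 1) :
    g = 1 ∨ g = -1 := by
  have h00 := congrArg (fun m : SL(2, ZMod q) => m 0 0) h
  have h01 := congrArg (fun m : SL(2, ZMod q) => m 0 1) h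
  have h10 := congrArg (fun m : SL(2, ZMod q) => m 1 0) h
  have h11 := congrArg (fun m : SL(2, ZMod q) => m 1 1) h
  simp only [mul_apply_two, Matrix.SpecialLinearGroup.coe_one, Matrix.one_apply_eq, Matrix.one_apply_ne,
    ne_eq, zero_ne_one, not_false_eq_true, one_ne_zero] at h00 h01 h10 h11
  have hdet := det_two g
  by_cases had : g 0 0 + g 1 1 = 0
  · exfalso
    apply (neZero_two hq).out
    have h11' : g 1 1 = -g 0 0 := by linear_combination had
    rw [h11'] at hdet
    linear_combination -h00 - hdet
  · have hb : g 0 1 = 0 := by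
      have : g 0 1 * (g 0 0 + g 1 1) = 0 := by linear_combination h01
      rcases mul_eq_zero.1 this with h | h
      · exact h
      · exact absurd h had
    have hc : g 1 0 = 0 := by
      have : g 1 0 * (g 0 0 + g 1 1) = 0 := by linear_combination h10
      rcases mul_eq_zero.1 this with h | h
      · exact h
      · exact absurd h had
    rw [hb] at h00
    have ha : (g 0 0 - 1) * (g 0 0 + 1) = 0 := by linear_combination h00
    rcases mul_eq_zero.1 ha with ha | ha
    · left
      have ha' : g 0 0 = 1 := by linear_combination ha
      have hd' : g 1 1 = 1 := by
        rw [ha', hb, hc] at hdet; linear_combination hdet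
      ext i j
      fin_cases i <;> fin_cases j <;> simp [ha', hb, hc, hd']
    · right
      have ha' : g 0 0 = -1 := by linear_combination ha
      have hd' : g 1 1 = -1 := by
        rw [ha', hb, hc] at hdet; linear_combination -hdet
      ext i j
      fin_cases i <;> fin_cases j <;>
        simp [ha', hb, hc, hd', Matrix.SpecialLinearGroup.coe_neg]

/-- **A homomorphism on `SL₂(𝔽_q)` (`q` odd) all of whose values square to `1` is trivial.**  Every element is a
product of (at most four) elementary unipotent matrices, and an elementary unipotent `u(a) = u(a/2)²` is a square.
(So `SL₂(𝔽_q)` has no non-trivial homomorphism to a group of exponent `2`.) [folklore] -/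
theorem monoidHom_eq_one_of_forall_mul_self_eq_one (hq : q ≠ 2) {M : Type*} [Group M]
    (f : SL(2, ZMod q) →* M) (hf : ∀ x, f x * f x = 1) : f = 1 := by
  have h2 := (neZero_two hq).out
  -- elementary unipotents
  let U : ZMod q → SL(2, ZMod q) := fun a => ⟨!![1, a; 0, 1], by simp [Matrix.det_fin_two_of]⟩
  let L : ZMod q → SL(2, ZMod q) := fun a => ⟨!![1, 0; a, 1], by simp [Matrix.det_fin_two_of]⟩
  have hU : ∀ a b, U a * U b = U (a + b) := fun a b => by
    ext i j
    fin_cases i <;> fin_cases j <;> simp [U, Matrix.mul_apply, Fin.sum_univ_two]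
    ring
  have hL : ∀ a b, L a * L b = L (a + b) := fun a b => by
    ext i j
    fin_cases i <;> fin_cases j <;> simp [L, Matrix.mul_apply, Fin.sum_univ_two]
  have hfU : ∀ a, f (U a) = 1 := fun a => by
    have : U a = U (a / 2) * U (a / 2) := by rw [hU]; congr 1; field_simp; ring
    rw [this, map_mul]; exact hf _
  have hfL : ∀ a, f (L a) = 1 := fun a => by
    have : L a = L (a / 2) * L (a / 2) := by rw [hL]; congr 1; field_simp; ring
    rw [this, map_mul]; exact hf _
  -- elements with non-zero lower-left entry
  have key : ∀ g : SL(2, ZMod q), g 1 0 ≠ 0 → f g = 1 := by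
    intro g hc
    have hdet := det_two g
    have e00 : (U ((g 0 0 - 1) / g 1 0) * L (g 1 0) * U ((g 1 1 - 1) / g 1 0)) 0 0 = g 0 0 := by
      simp only [mul_apply_two]; simp [U, L]; field_simp; ring
    have e01 : (U ((g 0 0 - 1) / g 1 0) * L (g 1 0) * U ((g 1 1 - 1) / g 1 0)) 0 1 = g 0 1 := by
      simp only [mul_apply_two]; simp [U, L]; field_simp; linear_combination hdet
    have e10 : (U ((g 0 0 - 1) / g 1 0) * L (g 1 0) * U ((g 1 1 - 1) / g 1 0)) 1 0 = g 1 0 := by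
      simp only [mul_apply_two]; simp [U, L]
    have e11 : (U ((g 0 0 - 1) / g 1 0) * L (g 1 0) * U ((g 1 1 - 1) / g 1 0)) 1 1 = g 1 1 := by
      simp only [mul_apply_two]; simp [U, L]; field_simp; ring
    have hg : g = U ((g 0 0 - 1) / g 1 0) * L (g 1 0) * U ((g 1 1 - 1) / g 1 0) := by
      ext i j
      fin_cases i <;> fin_cases j
      · exact e00.symm
      · exact e01.symm
      · exact e10.symm
      · exact e11.symm
    rw [hg, map_mul, map_mul, hfU, hfL, hfU, one_mul, one_mul]
  ext g
  simp only [MonoidHom.one_apply]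
  by_cases hc : g 1 0 = 0
  · have hdet := det_two g
    rw [hc, mul_zero, sub_zero] at hdet
    have ha : g 0 0 ≠ 0 := fun h0 => by rw [h0, zero_mul] at hdet; exact zero_ne_one hdet
    have h1 : f (L 1 * g) = 1 := key (L 1 * g) (by simpa [mul_apply_two, L, hc] using ha)
    rwa [map_mul, hfL, one_mul] at h1
  · exact key g hc

/-- **Relative version.**  If `π : E → SL₂(𝔽_q)` is surjective (`q` odd) and `f : E → M` is a homomorphism which kills
`ker π` and all of whose values square to `1`, then `f` is trivial. [folklore] -/
theorem monoidHom_eq_one_of_forall_mul_self_eq_one_of_ker_le (hq : q ≠ 2) {E M : Type*} [Group E] [Group M]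
    (π : E →* SL(2, ZMod q)) (hπ : Function.Surjective π) (f : E →* M) (hker : π.ker ≤ f.ker)
    (hf : ∀ x, f x * f x = 1) : f = 1 := by
  let e : E ⧸ π.ker ≃* SL(2, ZMod q) := QuotientGroup.quotientKerEquivOfSurjective π hπ
  let fbar : E ⧸ π.ker →* M := QuotientGroup.lift π.ker f hker
  let g : SL(2, ZMod q) →* M := fbar.comp e.symm.toMonoidHom
  have hg : g = 1 := by
    refine monoidHom_eq_one_of_forall_mul_self_eq_one hq g fun x => ?_
    obtain ⟨y, rfl⟩ := e.surjective x
    obtain ⟨z, rfl⟩ := QuotientGroup.mk_surjective y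
    simp [g, fbar, hf]
  ext z
  have := DFunLike.congr_fun hg (e (QuotientGroup.mk z))
  simpa [g, fbar] using this

/-- **An element of `SL₂(𝔽_q)` (`q` odd) with `x² = -1` has trace zero** and satisfies `x₀₀² + x₀₁x₁₀ = -1`.
[folklore] -/
theorem add_eq_zero_of_mul_self_eq_neg_one (hq : q ≠ 2) (x : SL(2, ZMod q)) (hx : x * x = -1) :
    x 0 0 + x 1 1 = 0 ∧ x 0 0 * x 0 0 + x 0 1 * x 1 0 = -1 := by
  have h00 := congrArg (fun m : SL(2, ZMod q) => m 0 0) hx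
  have h01 := congrArg (fun m : SL(2, ZMod q) => m 0 1) hx
  have h10 := congrArg (fun m : SL(2, ZMod q) => m 1 0) hx
  have h11 := congrArg (fun m : SL(2, ZMod q) => m 1 1) hx
  simp only [mul_apply_two, Matrix.SpecialLinearGroup.coe_neg, Matrix.SpecialLinearGroup.coe_one,
    Matrix.neg_apply, Matrix.one_apply_eq, Matrix.one_apply_ne, ne_eq, zero_ne_one, not_false_eq_true,
    one_ne_zero, neg_zero] at h00 h01 h10 h11
  have hdet := det_two x
  refine ⟨?_, h00⟩
  by_contra had
  have hb : x 0 1 = 0 := by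
    have : x 0 1 * (x 0 0 + x 1 1) = 0 := by linear_combination h01
    rcases mul_eq_zero.1 this with h | h
    · exact h
    · exact absurd h had
  have hc : x 1 0 = 0 := by
    have : x 1 0 * (x 0 0 + x 1 1) = 0 := by linear_combination h10
    rcases mul_eq_zero.1 this with h | h
    · exact h
    · exact absurd h had
  rw [hb] at h00 hdet
  rw [hc] at h11
  -- `x₀₀² = -1 = x₁₁²`, `x₀₀ x₁₁ = 1`
  have hsub : (x 0 0 - x 1 1) * (x 0 0 + x 1 1) = 0 := by linear_combination h00 - h11
  rcases mul_eq_zero.1 hsub with h | h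
  · have h' : x 1 1 = x 0 0 := by linear_combination -h
    rw [h'] at hdet
    apply (neZero_two hq).out
    linear_combination h00 - hdet
  · exact had h

/-- **Any two square roots of `-1` in `SL₂(𝔽_q)` (`q` odd) are conjugate in `SL₂(𝔽_q)`.**  (They are conjugate to
`w = (0 -1; 1 0)` by `g = [v | xv]·m` with `m` in the centraliser torus of `w` chosen, by the two-squares identity
in `𝔽_q`, so that `det g = 1`.) [folklore] -/
theorem exists_conj_eq_of_mul_self_eq_neg_one (hq : q ≠ 2) (x y : SL(2, ZMod q)) (hx : x * x = -1)
    (hy : y * y = -1) : ∃ g : SL(2, ZMod q), g * x * g⁻¹ = y := by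
  have h2 := (neZero_two hq).out
  let w : SL(2, ZMod q) := ⟨!![0, -1; 1, 0], by simp [Matrix.det_fin_two_of]⟩
  -- Step 1: an `x` with `x² = -1` and `x₁₀ ≠ 0` is conjugate to `w`.
  have key : ∀ x : SL(2, ZMod q), x * x = -1 → x 1 0 ≠ 0 → ∃ g : SL(2, ZMod q), g * w * g⁻¹ = x := by
    intro x hx hc
    obtain ⟨htr, hrel⟩ := add_eq_zero_of_mul_self_eq_neg_one hq x hx
    obtain ⟨u, v, huv⟩ := ZMod.sq_add_sq q (x 1 0)⁻¹
    have hdetg : Matrix.det !![u + x 0 0 * v, -v + x 0 0 * u; x 1 0 * v, x 1 0 * u] = 1 := by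
      rw [Matrix.det_fin_two_of]
      have : x 1 0 * (x 1 0)⁻¹ = 1 := mul_inv_cancel₀ hc
      linear_combination x 1 0 * huv + this
    refine ⟨⟨_, hdetg⟩, ?_⟩
    rw [mul_inv_eq_iff_eq_mul]
    ext i j
    fin_cases i <;> fin_cases j <;> simp [w, Matrix.mul_apply, Fin.sum_univ_two]
    · linear_combination (-v) * hrel
    · linear_combination (-u) * hrel
    · linear_combination (-(x 1 0 * v)) * htr
    · linear_combination (-(x 1 0 * u)) * htr
  -- Step 2: every `x` with `x² = -1` is conjugate to `w`.
  have key2 : ∀ x : SL(2, ZMod q), x * x = -1 → ∃ g : SL(2, ZMod q), g * w * g⁻¹ = x := by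
    intro x hx
    by_cases hc : x 1 0 = 0
    · by_cases hb : x 0 1 = 0
      · -- diagonal case: conjugate by the lower unipotent `l`
        obtain ⟨htr, hrel⟩ := add_eq_zero_of_mul_self_eq_neg_one hq x hx
        let l : SL(2, ZMod q) := ⟨!![1, 0; 1, 1], by simp [Matrix.det_fin_two_of]⟩
        have hx' : l * x * l⁻¹ * (l * x * l⁻¹) = -1 := by
          calc l * x * l⁻¹ * (l * x * l⁻¹) = l * (x * x) * l⁻¹ := by group
            _ = -1 := by rw [hx]; simp
        have ha : x 0 0 ≠ 0 := by
          intro h0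
          rw [h0, hb] at hrel
          simp at hrel
        have hc' : (l * x * l⁻¹) 1 0 ≠ 0 := by
          have e : (l * x * l⁻¹) 1 0 = 2 * x 0 0 := by
            simp only [mul_apply_two]
            simp [l, Matrix.SpecialLinearGroup.coe_inv, Matrix.adjugate_fin_two, hb, hc]
            linear_combination -htr
          rw [e]
          exact mul_ne_zero h2 ha
        obtain ⟨g, hg⟩ := key _ hx' hc'
        refine ⟨l⁻¹ * g, ?_⟩
        calc l⁻¹ * g * w * (l⁻¹ * g)⁻¹ = l⁻¹ * (g * w * g⁻¹) * l := by group
          _ = x := by rw [hg]; group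
      · -- `x₁₀ = 0`, `x₀₁ ≠ 0`: conjugate by `w`
        have hx' : w * x * w⁻¹ * (w * x * w⁻¹) = -1 := by
          calc w * x * w⁻¹ * (w * x * w⁻¹) = w * (x * x) * w⁻¹ := by group
            _ = -1 := by rw [hx]; simp
        have hc' : (w * x * w⁻¹) 1 0 ≠ 0 := by
          have e : (w * x * w⁻¹) 1 0 = -x 0 1 := by
            simp only [mul_apply_two]
            simp [w, Matrix.SpecialLinearGroup.coe_inv, Matrix.adjugate_fin_two, hc]
          rw [e]
          exact neg_ne_zero.2 hb
        obtain ⟨g, hg⟩ := key _ hx' hc'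
        refine ⟨w⁻¹ * g, ?_⟩
        calc w⁻¹ * g * w * (w⁻¹ * g)⁻¹ = w⁻¹ * (g * w * g⁻¹) * w := by group
          _ = x := by rw [hg]; group
    · exact key x hx hc
  obtain ⟨gx, hgx⟩ := key2 x hx
  obtain ⟨gy, hgy⟩ := key2 y hy
  refine ⟨gy * gx⁻¹, ?_⟩
  calc gy * gx⁻¹ * x * (gy * gx⁻¹)⁻¹ = gy * (gx⁻¹ * x * gx) * gy⁻¹ := by group
    _ = gy * w * gy⁻¹ := by rw [← hgx]; group
    _ = y := hgy

end SL2ZModOddPrime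

end Summit.BirchSwinnertonDyer.BirchSwinnertonDyer.Theorems.ManinLocalTwoThree
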